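import Summits.QuantumFields.YangMills.Theorems.BalabanUVNodesK0AxTangentSocket
import Summits.QuantumFields.YangMills.Theorems.BalabanUVNodesN12FlatCombAxialRepr
import Literature.MathematicalPhysics.QuantumFieldTheory.BalabanImbrieJaffe1984to88.BIJ88RT51Background
import HarnessLib

/-!
# BalabanUVNodes ∕ K0ᴬ — NEGATIVE EDGE on the «rooting is a gradient at first order» road: the flat CONSTRAINT dictionary (J-cons′) `FlatConsDictionary` is UNINHABITABLE at the
# canonical flat log chart `Ψ₀ = msChart F 2 K (k+1) (atScale (k+1)) (M˙1) 1` — DEF-1's STRAIGHT average `Q_{k+1}` ([B6] (2.6)) and Node00's CONTOUR average `Q_{k+1}(1)` ([15] (44)–(48)) differ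
# by the COMB of the block-centre contours, a pure-gauge term
# (FILE 10 of the cut; consumes ✓`…K0AxTangentSocket` §4b (`FlatConsDictionary`), ✓`…N12FlatCombAxialRepr` (`fderiv_msChart_one_sub_centreGrad`), ✓`B5Eq120IterProof.bondAvgIter_grad`,
# ✓`B5Eq118OneStroke.siteAvgIter_eq_blockSum`, ✓`B6SectAOperatorsV1.QE_apply` by name)

LANDING NOTE (porter ▶ PTC-1 g4, 2026-08-31; AUTHORSHIP = ◇ lens-1 g11 «cauchy-analytic» (CANDIDATE 8 = FILE 10 `nodeO-cover/LENS-1g11-ConsNeg-v1.lean` 0e530fcfd7d6ec47 · 227 l. · 7 thm), landed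
in ◆ CRIT-1 g38's REUSE edition v1.1 `ym-nodeO-crit-1/g38/LENS1g11_ConsNeg_v1p1.lean` sha16 e5e5a6abe00cd4da · 214 l. · 6 thm, no `def`, 0 sorry = v1 with the folklore `torusShift_ne_self` DELETED
and its one use re-pointed to the canonical Lit ✓`T4WilsonLinkAffine.shift_ne_self` (already in the import closure; the gate's dry-run had named v1's copy a `dedup.landed` twin) — otherwise
byte-identical): landed VERBATIM (only this paragraph added) under the basename ◇ lens-1 proposed (`…Theorems/BalabanUVNodesK0AxTangentSocketConsNeg.lean`, ns `K0AxCtabUniq`); imports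
✓`…K0AxTangentSocket` + ✓`…N12FlatCombAxialRepr` + ✓`BIJ88RT51Background`; `--supports stmt-QuantumFields-27238 --as helper` (NO `--workitem`; kind proof; a NEGATIVE helper — its conclusion
asserts no Theses decl); ◆ CRIT-1 g38's ruling + cut (nodeO STATUS 12:28:58Z ∕ 12:32:16Z): (J-cons′)@Ψ₀ = `FlatConsDictionary F θ k K Ψ₀ datum` at the flat log chart `Ψ₀ := msChart F 2 K (k+1)
(atScale (k+1)) (avgFamily (avOfRecord F 2 K) 1) 1` is REFUTED-MISSTATED as a displayed letter (◇ self-audit 12:19:05Z + ★★ DEF-1 g38 12:24:49Z concur: `DΨ₀(0)` = the CONTOUR average `qLin`,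
DEF-1's `QE (univDomains)` = [B6]'s STRAIGHT average; equal exactly modulo the COMB gradient `∂Λ_{k+1}`; repaired letter C′ = (J-cons″) mod-gauge, FILE 11); THIS FILE's
★★★`not_flatConsDictionary_msChart_flat` is the KERNEL CERTIFICATE; CUSTODY STAMP OF RECORD: the four landed finals that take `Jcons` AT Ψ₀ — ✓p822476 `…K0AxTangentSocketPsi` :342
`rootedReceipts_of_tokens_atScale_flatLogChart` and ✓p822694 `…K0AxTangentSocketOnto` :155 `…_flatLogChart_onto` ∕ :207 `…_lieExpo` ∕ :263 `…_recordScheme` — are VACUOUS-AS-TYPED (true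
implications from an uninhabitable binder, zero content; nothing landed is false); CUT RULE from now: any candidate taking `FlatConsDictionary F θ k K Ψ₀ _` at this Ψ₀ as a binder, or consuming
one of those four finals, is NO-GO on sight; J1′∕J4∕J5′ PASS, axioms standard guarded on all 6.  HONEST (porter): a kernel NEGATIVE about a displayed letter at one chart + finite lattice
bookkeeping; nothing of Bałaban asserted, ported, discharged or refuted; K0ᴬ stmt-QuantumFields-27238 ∕ K0⁷ 20541 OPEN — NOTHING of them proved; NODE O 0∕1; COUNT 8∕28 · K 1∕4 UNMOVED; finite 𝕋⁴
at fixed ε — NOT continuum ∕ OS ∕ Clay; the Yang–Mills mass gap is NOT proved by any of this.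

Cell `pub-ymgap` (YM-PLAN Track A, D-0062 ∕ D-0149 ∕ D-0171), NODE O lens seat `ymgap-nodeO-lens-1` (g11), filed by the porter `--kind proof --supports stmt-QuantumFields-27238 --as helper`,
COUNT-NEUTRAL.  NEW leaf; theorems only — 0 `def`, 0 `sorry`, 0 `instance`, 0 `notation`, no `set_option`; standard axioms.  [15] = [Balaban1985Variational]; [B5] = [Balaban1984PropagatorsI];
[B6] = [Balaban1984PropagatorsII]; [I] = [Balaban1987RG1].

WHAT (self-audit of a displayed letter of this seat's own chain).  (J-cons′) `FlatConsDictionary F θ k K Ψ datum` (✓`…K0AxTangentSocket` :234) says: every Lie-algebra field `Y` whose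
LINEARISED CHART VALUE `DΨ(0)Y` equals the datum velocity `D datum(0)(respDir a l)` has DEF-1's K0 constraint `QE (univDomains)` of its `ξ⁻¹`·re∕im entries EQUAL to `ρ₈(bV a)_{ii′} • windowSrc l`.
At `Ψ₀ =` Node00's flat multi-scale chart with level-`(k+1)` constraints the premise pins `DΨ₀(0)Y = π ∘ Q_{k+1}(1) Y` — the linearised BAŁABAN average, which takes each fine bond variable
along block-centre CONTOURS ([15] (0.4)∕(118), (44)–(48)): it KILLS every fine pure gauge `dψ` whose potential vanishes at the `(k+1)`-fold centres (✓`fderiv_msChart_one_sub_centreGrad`).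
DEF-1's `QE (univDomains)` is [B6] (2.6)'s STRAIGHT iterated average `bondAvgIter (k+1)` (✓`QE_apply`), and `Q_{k+1}∂χ = ∂(Q′_{k+1}χ)` up to the lattice factor (✓`bondAvgIter_grad`, [B5] (1.20)):
for `χ = δ_{x₀}`, `x₀` a NON-centre fine site (they exist since `1 < L`), `Q′_{k+1}δ_{x₀}` is `L^{-d(k+1)}` on the block of `x₀` and `0` on its neighbour, so the straight average of `∂δ_{x₀}`
at the coarse bond leaving that block is NONZERO.  Hence `Y₀` and `Y₀ − ∂(δ_{x₀}·E)` (`E = [[0,1],[−1,0]] ∈ 𝔰𝔲(2)`, real `(0,1)` entry) have the same `DΨ₀(0)`-image and different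
`QE (univDomains)(re ξ⁻¹(·)₀₁)`, and (J-cons′)'s conclusion cannot hold for both; a `Y₀` meeting the premise exists as soon as `DΨ₀(0)` is ONTO (true on `k + 2 ≤ m + K`, FILE 9 §4i
★★`surjective_fderiv_msChart_flat_atScale`; displayed here as `hon` so that this file does not wait for FILE 9).  Print's name for the mismatch is the COMB: `Q_j(1) = L^j·Q_j − ∂Λ_j`
([15] (47)–(48); [B6] works with the straight `Q_j` because the comb is a gauge term, absorbed by (2.7)–(2.8)).
* §1 `e01_mem_lieSU` (`[[0,1],[−1,0]] ∈ 𝔰𝔲(2)`), (a coarse torus has ≥ 2 sites per direction: ✓`T4WilsonLinkAffine.shift_ne_self`, reused), `exists_forall_embIter_ne` (a non-centre fine site), `mem_Om_univDomains_top`,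
  `lamBond_univDomains_top` (every `(k+1)`-bond indexes a constraint of `univDomains`), `bondAvgIter_grad_bump_ne_zero` (THE NUMBER: the straight `(k+1)`-fold average of `∂(c·δ_{x₀})` at the
  bond `⟨B^{k+1}(x₀), μ⟩` is `−c·L^{-(k+1)}·L^{-d(k+1)} ≠ 0`).
* §2 ★★★ `not_flatConsDictionary_msChart_flat` — `k + 1 ≤ m + K`, `DΨ₀(0)` onto, `a : ιβ`, `l` a label ⟹ `¬ FlatConsDictionary F θ k K Ψ₀ datum` for EVERY `datum`.

CONSEQUENCE FOR THE CHAIN (honest).  The finals typed AT `Ψ₀` — ✓`…K0AxTangentSocketPsi` ★★★`rootedReceipts_of_tokens_atScale_flatLogChart` and FILE 9's §4i–§4k finals — carry the binder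
`Jcons : FlatConsDictionary F θ k K Ψ₀ …`; on `k + 2 ≤ m + K` (where §4i makes `DΨ₀(0)` onto) that binder is uninhabitable, so those finals are VACUOUS as typed (correct implications,
zero content).  Nothing landed is false.  The REPAIR is the mod-gauge socket (FILE 11): the rooted receipts are mod UNRESTRICTED gauge already (✓`criticalModGauge_iff_chart`:
(C-wcg)ᵣ ↔ `ChartResponseCriticalModGaugeAt U`), so the constraint dictionary is weakened to (J-cons″) «… ∃ φ₀, `QE(univDomains)(re∕im ξ⁻¹(Y − ∂φ₀)ᵢᵢ′) = ρ₈ • windowSrc`», which the comb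
identity makes TRUE at `Ψ₀` (`φ₀ :=` the comb `Λ_{k+1}Y` made block-constant).  The abstract socket theorems over a general `Ψ` (FILE 56 §4b, FILE 58∕60) are untouched: (J-cons′) is
false for `Ψ₀`, not for every `Ψ` (a chart whose linearisation IS the straight average would satisfy it — Node00's is not one).

HONEST FRAMING (binding).  Finite lattice linear algebra over `ℝ` on the tree's two averaging operators; NOTHING of Bałaban asserted, ported or discharged; this file REFUTES a displayed
letter of the seat's own conditional chain at one chart, it proves nothing of K0ᴬ: `stmt-QuantumFields-27238` (K0ᴬ) and `…-20541` (K0⁷) remain OPEN — NOTHING of them is proved here;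
(C-tab-opt) stays STRUCK (№543) and is not re-entered; NODE O 0∕1; COUNT 8∕28 · K 1∕4 UNMOVED; one finite 𝕋⁴ programme at fixed ε — NOT continuum ∕ ℝ⁴ ∕ OS; **the Yang–Mills mass gap
(Clay) is NOT proved by any of this.**
-/

noncomputable section

open Filter Topology
open scoped BigOperators Matrix.Norms.L2Operator

namespace Summit.QuantumFields.YangMills.Theorems.K0AxCtabUniq

open Literature.MathematicalPhysics.QuantumFieldTheory.Balaban1983to89
open LatticeFieldCalculus B6SectADomainsV1 B6SectAOperatorsV1 B6SectAVectorModelV1 B6SectACriticalPointV1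
open Literature.MathematicalPhysics.QuantumFieldTheory.Balaban1983to89.T4Continuum (T4Family)
open Literature.MathematicalPhysics.QuantumFieldTheory.Balaban1983to89.Node00
open Summit.QuantumFields.YangMills.Theorems.K0RecordFormatNames
open T4AdjointCovarianceUnitary (lieSU mem_lieSU_iff)
open B15DeterminingSets (DetSet MSField atScale embIter avgFamily)
open B5Eq118OneStroke (iterBlockOf iterBlock mem_iterBlock siteAvgIter_eq_blockSum)
open B5Eq120IterProof (bondAvgIter_grad)
open B6SectAOntoV1 (bondAvgIterLin bondAvgIterLin_apply)
open Literature.MathematicalPhysics.QuantumFieldTheory.BalabanImbrieJaffe1984to88.BIJ85AxialPropagator411 (BondSpace)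
open Literature.MathematicalPhysics.QuantumFieldTheory.BalabanImbrieJaffe1984to88.BIJ88RT51Background (iterBlockOf_embIter)
open Summit.QuantumFields.YangMills.BalabanUVNodes.N12FlatCombAxialRepr (fderiv_msChart_one_sub_centreGrad)

variable (F : T4Family) (θ : Stage13Params F 2)

/-! ## §1  The witnesses: a real-entry element of `𝔰𝔲(2)`, a non-centre fine site, the top-level constraint index, and THE NUMBER -/

section Witness

/-- `E = [[0,1],[−1,0]]` is trace-free skew-Hermitian: an element of `𝔰𝔲(2)` with a nonzero REAL entry. [folklore] -/
theorem e01_mem_lieSU : (!![0, 1; -1, 0] : Matrix (Fin 2) (Fin 2) ℂ) ∈ lieSU (Fin 2) := by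
  refine mem_lieSU_iff.2 ⟨?_, ?_⟩
  · ext i j
    fin_cases i <;> fin_cases j <;> simp [Matrix.star_apply]
  · simp [Matrix.trace, Fin.sum_univ_two]

variable {P : Params}

/-- **A NON-CENTRE FINE SITE EXISTS** (`1 < L`, `1 ≤ d`): some `x₀ ∈ T^{(0)}` is not the `(k+1)`-fold centre `embIter (k+1) y` of any coarse site. [cite: Balaban1987RG1, (0.1) p.251 (bookkeeping)] -/
theorem exists_forall_embIter_ne {k : ℕ} (hk : k + 1 ≤ P.m + P.K) (μ : Fin P.d) :
    ∃ x₀ : Site P 0, ∀ y : Site P (k + 1), embIter (k + 1) y ≠ x₀ := by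
  classical
  have hμ : 0 < P.d := Fin.pos μ
  let y₁ : Site P (k + 1) := default
  have hcard : 1 < (iterBlock (k + 1) y₁).card := by
    rw [B5Eq118OneStroke.card_iterBlock (k + 1) hk y₁]
    have hL : 1 < P.L := P.hL.2
    calc 1 = (1 ^ P.d) ^ (k + 1) := by simp
      _ < (P.L ^ P.d) ^ (k + 1) := by
          apply Nat.pow_lt_pow_left _ (by omega)
          exact Nat.pow_lt_pow_left hL (by omega)
  obtain ⟨x₀, hx₀, hne⟩ := Finset.exists_mem_ne hcard (embIter (k + 1) y₁)
  refine ⟨x₀, fun y hy => ?_⟩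
  have h1 : iterBlockOf (k + 1) x₀ = y₁ := (mem_iterBlock (k + 1) y₁ x₀).1 hx₀
  have h2 : iterBlockOf (k + 1) x₀ = y := by rw [← hy, iterBlockOf_embIter (k + 1) hk y]
  exact hne (by rw [← hy, ← h2, h1])

end Witness

section Index

variable {F}

/-- At the window `W = univ` every `(k+1)`-site lies in `Ω_{k+1}` of DEF-1's domain family. [cite: Balaban1984PropagatorsII, (2.1)–(2.3) p.224 (bookkeeping)] -/
theorem mem_Om_univDomains_top {K k : ℕ} (hk : k + 1 ≤ (F.P K).m + (F.P K).K) (y : Site (F.P K) (k + 1)) :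
    y ∈ (univDomains F k K hk).Om (k + 1) := by
  simp [univDomains, windowDomains]

/-- Every `(k+1)`-bond is a constraint index of `univDomains` (`Λ_{k+1} = T^{(k+1)}`). [cite: Balaban1984PropagatorsII, (2.3) p.224 (bookkeeping)] -/
theorem lamBond_univDomains_top {K k : ℕ} (hk : k + 1 ≤ (F.P K).m + (F.P K).K) (c : PBond (F.P K) (k + 1)) :
    (univDomains F k K hk).LamBond (k + 1) c :=
  ((univDomains F k K hk).lamBond_top_iff c).2 (Or.inl (mem_Om_univDomains_top hk c.src))

end Index

section Number

variable {P : Params}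

/-- **THE NUMBER**: the straight `(k+1)`-fold average of the fine gradient `∂(c·δ_{x₀})` (`c ≠ 0`) at the coarse bond `⟨B^{k+1}(x₀), μ⟩` is `c·L^{-(k+1)}·(0 − L^{-d(k+1)}) ≠ 0`
([B5] (1.20): `Q_{k+1}∂ = ∂Q′_{k+1}`; `Q′_{k+1}δ_{x₀}` is `L^{-d(k+1)}` on the block of `x₀` and `0` on the next block). [cite: Balaban1984PropagatorsI, (1.20) p.20, (1.13) p.19] -/
theorem bondAvgIter_grad_bump_ne_zero {k : ℕ} (hk : k + 1 ≤ P.m + P.K) {c : ℝ} (hc : c ≠ 0) (x₀ : Site P 0) (μ : Fin P.d) :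
    bondAvgIter (k + 1) (grad c fun x : Site P 0 => if x = x₀ then (1 : ℝ) else 0) ⟨iterBlockOf (k + 1) x₀, μ⟩ ≠ 0 := by
  classical
  rw [bondAvgIter_grad (k + 1) hk c]
  have hval : ∀ y : Site P (k + 1), siteAvgIter (k + 1) (fun x : Site P 0 => if x = x₀ then (1 : ℝ) else 0) y =
      ((((P.L : ℝ) ^ P.d) ^ (k + 1))⁻¹) * (if iterBlockOf (k + 1) x₀ = y then 1 else 0) := by
    intro y
    rw [siteAvgIter_eq_blockSum (k + 1) hk _ y, Finset.sum_ite_eq', smul_eq_mul]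
    simp only [mem_iterBlock]
  have hne : (Site.shift (iterBlockOf (k + 1) x₀) μ) ≠ iterBlockOf (k + 1) x₀ := T4WilsonLinkAffine.shift_ne_self _ μ
  have hL : (0 : ℝ) < P.L := Nat.cast_pos.2 P.L_pos
  have h1 : (((P.L : ℝ) ^ P.d) ^ (k + 1))⁻¹ ≠ 0 := inv_ne_zero (by positivity)
  have h2 : c / (P.L : ℝ) ^ (k + 1) ≠ 0 := div_ne_zero hc (by positivity)
  simp only [grad, PBond.tgt, hval, smul_eq_mul, if_neg (Ne.symm hne), if_true, mul_zero, zero_sub, mul_one, mul_neg, ne_eq, neg_eq_zero]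
  exact mul_ne_zero h2 h1

end Number

/-! ## §2  (J-cons′) is uninhabitable at the flat log chart -/

section Neg

open scoped InnerProductSpace

/-- ★★★ **(J-cons′) IS UNINHABITABLE AT `Ψ₀ = msChart F 2 K (k+1) (atScale (k+1)) (M˙1) 1`**: on `k + 1 ≤ m + K`, as soon as `DΨ₀(0)` is onto (FILE 9 §4i on `k + 2 ≤ m + K`), for any index
`a` and label `l`, NO `datum` makes `FlatConsDictionary F θ k K Ψ₀ datum` true — the straight K0 constraint sees the centre-vanishing pure gauge `∂(δ_{x₀}·E)` that `DΨ₀(0)` kills.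
[cite: Balaban1985Variational, (44)–(48) p.285, (36) p.283; Balaban1984PropagatorsII, (2.6)–(2.8) p.224; Balaban1984PropagatorsI, (1.20) p.20] -/
theorem not_flatConsDictionary_msChart_flat (K k : ℕ) (hk : k + 1 ≤ (F.P K).m + (F.P K).K)
    (hon : Function.Surjective
      (fderiv ℝ (msChart F 2 K (k + 1) (atScale (k + 1)) (avgFamily (avOfRecord F 2 K) (1 : GaugeField (F.P K) 0 (SU 2))) (1 : GaugeField (F.P K) 0 (SU 2))) 0))
    (a : θ.ιβ) (l : RespLabel F k K)
    (datum : (Fin (F.P K).d → Site (F.P K) (k + 1) → θ.Vβ) → Fin (constrCard (atScale (k + 1) : DetSet (F.P K)) (k + 1)) → lieSU (Fin 2)) :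
    ¬ FlatConsDictionary F θ k K
        (msChart F 2 K (k + 1) (atScale (k + 1)) (avgFamily (avOfRecord F 2 K) (1 : GaugeField (F.P K) 0 (SU 2))) (1 : GaugeField (F.P K) 0 (SU 2))) datum := by
  classical
  letI := θ.instVβ₁; letI := θ.instVβ₂
  intro J
  obtain ⟨Y₀, hY₀⟩ := hon (fderiv ℝ datum 0 (respDir F θ k K a l))
  obtain ⟨x₀, hx₀⟩ := exists_forall_embIter_ne (P := F.P K) hk l.1
  -- the bump potential `δ_{x₀}·E`
  let e : lieSU (Fin 2) := ⟨!![0, 1; -1, 0], e01_mem_lieSU⟩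
  let ψ : Site (F.P K) 0 → lieSU (Fin 2) := fun x => if x = x₀ then e else 0
  have hψ : ∀ y : Site (F.P K) (k + 1), ψ (embIter (k + 1) y) = 0 := fun y => if_neg (hx₀ y)
  have hψe : ∀ x : Site (F.P K) 0, ((ψ x : lieSU (Fin 2)) : Matrix (Fin 2) (Fin 2) ℂ) 0 1 = if x = x₀ then 1 else 0 := by
    intro x
    by_cases hx : x = x₀
    · simp [ψ, hx, e]
    · simp [ψ, hx]
  let Y₁ : PBond (F.P K) 0 → lieSU (Fin 2) := fun b => Y₀ b - (ψ b.tgt - ψ b.src)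
  have hY₁ : fderiv ℝ (msChart F 2 K (k + 1) (atScale (k + 1)) (avgFamily (avOfRecord F 2 K) (1 : GaugeField (F.P K) 0 (SU 2)))
      (1 : GaugeField (F.P K) 0 (SU 2))) 0 Y₁ = fderiv ℝ datum 0 (respDir F θ k K a l) := by
    rw [← hY₀]
    exact fderiv_msChart_one_sub_centreGrad (F := F) (N := 2) (atScale (k + 1)) (fun j hj => by simp [atScale, hj]) Y₀ hψ
  have h0 := (J hk a l 0 1 Y₀ hY₀).1
  have h1 := (J hk a l 0 1 Y₁ hY₁).1
  -- the two straight constraints agree; evaluate at the top-level index of the bond leaving the block of `x₀`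
  let c₀ : PBond (F.P K) (k + 1) := ⟨iterBlockOf (k + 1) x₀, l.1⟩
  let idx : BondIdx (univDomains F k K hk) := ⟨⟨⟨k + 1, Nat.lt_succ_self _⟩, c₀⟩, lamBond_univDomains_top hk c₀⟩
  have key := congrArg (fun ω : BondIdxSpace (univDomains F k K hk) => ω idx) (h0.trans h1.symm)
  simp only [QE_apply] at key
  -- the real parts differ by the gradient of the bump
  set χ : Site (F.P K) 0 → ℝ := fun x => if x = x₀ then (1 : ℝ) else 0 with hχ
  have hre : WithLp.ofLp (reBond F K fun b => (((F.P K).eta (k + 1))⁻¹ : ℂ) * ((Y₁ b : lieSU (Fin 2)) : Matrix (Fin 2) (Fin 2) ℂ) 0 1) =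
      WithLp.ofLp (reBond F K fun b => (((F.P K).eta (k + 1))⁻¹ : ℂ) * ((Y₀ b : lieSU (Fin 2)) : Matrix (Fin 2) (Fin 2) ℂ) 0 1) -
        grad (((F.P K).eta (k + 1))⁻¹) χ := by
    funext b
    simp only [reBond, WithLp.ofLp_toLp, Pi.sub_apply, grad, hχ, smul_eq_mul, Y₁, Submodule.coe_sub, Matrix.sub_apply, hψe,
      mul_sub, Complex.sub_re, ← Complex.ofReal_inv, Complex.re_ofReal_mul]
    split_ifs <;> simp
  rw [hre] at key
  have hlin : bondAvgIter (k + 1)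
        (WithLp.ofLp (reBond F K fun b => (((F.P K).eta (k + 1))⁻¹ : ℂ) * ((Y₀ b : lieSU (Fin 2)) : Matrix (Fin 2) (Fin 2) ℂ) 0 1) -
          grad (((F.P K).eta (k + 1))⁻¹) χ) c₀ =
      bondAvgIter (k + 1) (WithLp.ofLp (reBond F K fun b => (((F.P K).eta (k + 1))⁻¹ : ℂ) * ((Y₀ b : lieSU (Fin 2)) : Matrix (Fin 2) (Fin 2) ℂ) 0 1)) c₀ -
        bondAvgIter (k + 1) (grad (((F.P K).eta (k + 1))⁻¹) χ) c₀ := by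
    have := map_sub (bondAvgIterLin (F.P K) ℝ (k + 1))
      (WithLp.ofLp (reBond F K fun b => (((F.P K).eta (k + 1))⁻¹ : ℂ) * ((Y₀ b : lieSU (Fin 2)) : Matrix (Fin 2) (Fin 2) ℂ) 0 1))
      (grad (((F.P K).eta (k + 1))⁻¹) χ)
    simpa only [bondAvgIterLin_apply, Pi.sub_apply] using congrFun this c₀
  rw [hlin] at key
  have hzero : bondAvgIter (k + 1) (grad (((F.P K).eta (k + 1))⁻¹) χ) c₀ = 0 := by linarith
  have heta : ((F.P K).eta (k + 1))⁻¹ ≠ 0 := by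
    have hL : (0 : ℝ) < (F.P K).L := Nat.cast_pos.2 (F.P K).L_pos
    exact inv_ne_zero (by unfold Params.eta; positivity)
  exact bondAvgIter_grad_bump_ne_zero (P := F.P K) hk heta x₀ l.1 hzero

end Neg

end Summit.QuantumFields.YangMills.Theorems.K0AxCtabUniq

end
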